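import Literature.MathematicalPhysics.QuantumFieldTheory.QCDOS

/-!
# Stub `stub_twoLoopHandOver` of line `proper-time-quarantine`
(crux `Summit.QuantumFields.QCD.Theses.NestedDissectionSea.SeaFactorisationBridge`,
item stmt-QuantumFields-13880)

The two-loop coupling hand-over is a pure-gauge profile (decoupling / matching arithmetic over
the tree's `afBeta`, `betaCoeff₀`, `betaCoeff₁`).  For every flavour number `N_f`, lattice
Λ-parameter `Λ > 0` and heavy threshold `M > 0`, the pure-gauge Λ-parameter
`Λ′ = exp ((b₀(N_f) log Λ + (b₀(0) − b₀(N_f)) log M) / b₀(0))` satisfies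
`afBeta 0 Λ′ a − [afBeta N_f Λ a + 2(b₀(0) − b₀(N_f)) log(1/(a²M²))
  + 2(b₁(0)/b₀(0) − b₁(N_f)/b₀(N_f)) log log(1/(a²Λ²))] → 0` as `a → 0⁺`:
writing `u = log(a⁻²) → +∞` and `log(1/(a²X²)) = u + log(X⁻²)`, the coefficient of `u` cancels
identically, the constant term cancels by the choice of `Λ′`, and the remaining bracket is
`2(b₁(0)/b₀(0)) (log(u + c′) − log(u + c)) = 2(b₁(0)/b₀(0)) log((u + c′)/(u + c)) → 0`.
Mathlib real analysis only.
-/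

noncomputable section

namespace Summit.QuantumFields.QCD.Cruxes.SeaFactorisationBridge.ProperTimeQuarantine

open Filter Topology
open Literature.MathematicalPhysics.QuantumFieldTheory

/-- `log(u + c′) − log(u + c) → 0` as `u → +∞` (the log of a ratio tending to `1`). [folklore] -/
theorem handOver_tendsto_log_add_sub_log_add (c c' : ℝ) :
    Tendsto (fun u : ℝ => Real.log (u + c') - Real.log (u + c)) atTop (𝓝 0) := by
  have h1 : Tendsto (fun u : ℝ => u + c) atTop atTop :=
    tendsto_atTop_add_const_right _ c tendsto_id
  have h2 : Tendsto (fun u : ℝ => (c' - c) / (u + c)) atTop (𝓝 0) :=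
    tendsto_const_nhds.div_atTop h1
  have h3 : Tendsto (fun u : ℝ => 1 + (c' - c) / (u + c)) atTop (𝓝 1) := by
    simpa using tendsto_const_nhds.add h2
  have h4 : Tendsto (fun u : ℝ => Real.log (1 + (c' - c) / (u + c))) atTop (𝓝 0) := by
    have := h3.log one_ne_zero
    rwa [Real.log_one] at this
  refine h4.congr' ?_
  filter_upwards [eventually_gt_atTop (max (-c) (-c'))] with u hu
  have hc : 0 < u + c := by linarith [le_max_left (-c) (-c')]
  have hc' : 0 < u + c' := by linarith [le_max_right (-c) (-c')]
  have h5 : 1 + (c' - c) / (u + c) = (u + c') / (u + c) := by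
    field_simp
    ring
  rw [h5, Real.log_div hc'.ne' hc.ne']

/-- `log(a⁻²) → +∞` as `a → 0⁺`. [folklore] -/
theorem handOver_tendsto_log_inv_sq_nhdsGT_zero :
    Tendsto (fun a : ℝ => Real.log ((a ^ 2)⁻¹)) (𝓝[>] 0) atTop := by
  have hsq : Tendsto (fun a : ℝ => a ^ 2) (𝓝[>] (0 : ℝ)) (𝓝[>] 0) := by
    refine tendsto_nhdsWithin_iff.2 ⟨?_, ?_⟩
    · have h0 : Tendsto (fun a : ℝ => a ^ 2) (𝓝 0) (𝓝 0) := by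
        simpa using ((continuous_pow 2).tendsto (0 : ℝ))
      exact h0.mono_left nhdsWithin_le_nhds
    · filter_upwards [self_mem_nhdsWithin] with a ha
      exact pow_pos (Set.mem_Ioi.1 ha) 2
  exact Real.tendsto_log_atTop.comp (tendsto_inv_nhdsGT_zero.comp hsq)

/-- `log(1/(a²X²)) = log(a⁻²) + log(X⁻²)` for `a, X > 0`. [folklore] -/
theorem handOver_log_one_div_sq_mul_sq {a X : ℝ} (ha : 0 < a) (hX : 0 < X) :
    Real.log (1 / (a ^ 2 * X ^ 2)) = Real.log ((a ^ 2)⁻¹) + Real.log ((X ^ 2)⁻¹) := by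
  rw [one_div, mul_inv,
    Real.log_mul (inv_ne_zero (pow_ne_zero 2 ha.ne')) (inv_ne_zero (pow_ne_zero 2 hX.ne'))]

/-- `log(X⁻²) = −2 log X`. [folklore] -/
theorem handOver_log_inv_sq (X : ℝ) : Real.log ((X ^ 2)⁻¹) = -(2 * Real.log X) := by
  rw [Real.log_inv, Real.log_pow]
  push_cast
  ring

/-- **stub 3a — the two-loop coupling hand-over is a pure-gauge profile.**  For every flavour
number `N_f`, lattice Λ-parameter `Λ > 0` and heavy threshold `M > 0` there is a pure-gauge
Λ-parameter `Λ′ > 0` — namely `log Λ′ = [b₀(N_f) log Λ + (b₀(0) − b₀(N_f)) log M] / b₀(0)` — such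
that the `N_f`-flavour two-loop profile shifted by the one-loop heavy-threshold logarithm AND the
two-loop `log log` swap IS the pure-gauge two-loop profile at `Λ′` up to `o(1)` as `a → 0⁺`:
`afBeta 0 Λ′ a − [afBeta N_f Λ a + 2(b₀(0) − b₀(N_f)) log(1/(a²M²))
  + 2(b₁(0)/b₀(0) − b₁(N_f)/b₀(N_f)) log log(1/(a²Λ²))] → 0`
(the `log(1/a²)` coefficients cancel identically, the constants cancel by the choice of `Λ′`, and
`log log(1/(a²Λ′²)) − log log(1/(a²Λ²)) → 0` is the log of a ratio of logarithms tending to `1`).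
[cite: MontvayMunster1994, §3.3.3 (3.263)–(3.265) and §5.1 (5.66)–(5.67)] -/
theorem stub_twoLoopHandOver :
    ∀ (Nf : ℕ) (Λ M : ℝ), 0 < Λ → 0 < M → ∃ Λ' : ℝ, 0 < Λ' ∧
      Tendsto (fun a : ℝ => afBeta 0 Λ' a - (afBeta Nf Λ a +
        2 * (betaCoeff₀ 0 - betaCoeff₀ Nf) * Real.log (1 / (a ^ 2 * M ^ 2)) +
        2 * (betaCoeff₁ 0 / betaCoeff₀ 0 - betaCoeff₁ Nf / betaCoeff₀ Nf) *
          Real.log (Real.log (1 / (a ^ 2 * Λ ^ 2))))) (𝓝[>] 0) (𝓝 0) := by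
  intro Nf Λ M hΛ hM
  -- `b₀(0) = 11/(16π²) ≠ 0`
  have hb0 : betaCoeff₀ 0 ≠ 0 := by
    have h : 0 < betaCoeff₀ 0 := by unfold betaCoeff₀; norm_num; positivity
    exact h.ne'
  -- the pure-gauge Λ-parameter `Λ′ = exp ℓ`, `b₀(0) ℓ = b₀(N_f) log Λ + (b₀(0) − b₀(N_f)) log M`
  obtain ⟨ℓ, hℓ⟩ : ∃ ℓ : ℝ, betaCoeff₀ 0 * ℓ =
      betaCoeff₀ Nf * Real.log Λ + (betaCoeff₀ 0 - betaCoeff₀ Nf) * Real.log M :=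
    ⟨_, mul_div_cancel₀ _ hb0⟩
  refine ⟨Real.exp ℓ, Real.exp_pos ℓ, ?_⟩
  -- the constant term vanishes by the choice of `ℓ`
  have hK : 2 * betaCoeff₀ 0 * Real.log ((Real.exp ℓ ^ 2)⁻¹) -
      2 * betaCoeff₀ Nf * Real.log ((Λ ^ 2)⁻¹) -
      2 * (betaCoeff₀ 0 - betaCoeff₀ Nf) * Real.log ((M ^ 2)⁻¹) = 0 := by
    rw [handOver_log_inv_sq (Real.exp ℓ), handOver_log_inv_sq Λ, handOver_log_inv_sq M,
      Real.log_exp]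
    linear_combination (-4 : ℝ) * hℓ
  -- the `log log` bracket tends to `0`
  have hlim : Tendsto (fun a : ℝ => 2 * (betaCoeff₁ 0 / betaCoeff₀ 0) *
      (Real.log (Real.log ((a ^ 2)⁻¹) + Real.log ((Real.exp ℓ ^ 2)⁻¹)) -
        Real.log (Real.log ((a ^ 2)⁻¹) + Real.log ((Λ ^ 2)⁻¹)))) (𝓝[>] 0) (𝓝 0) := by
    have := ((handOver_tendsto_log_add_sub_log_add (Real.log ((Λ ^ 2)⁻¹))
      (Real.log ((Real.exp ℓ ^ 2)⁻¹))).comp handOver_tendsto_log_inv_sq_nhdsGT_zero).const_mul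
      (2 * (betaCoeff₁ 0 / betaCoeff₀ 0))
    rw [mul_zero] at this
    exact this
  refine hlim.congr' ?_
  filter_upwards [self_mem_nhdsWithin] with a ha
  have ha' : 0 < a := Set.mem_Ioi.1 ha
  simp only [afBeta, handOver_log_one_div_sq_mul_sq ha' hΛ, handOver_log_one_div_sq_mul_sq ha' hM,
    handOver_log_one_div_sq_mul_sq ha' (Real.exp_pos ℓ)]
  linear_combination -hK

end Summit.QuantumFields.QCD.Cruxes.SeaFactorisationBridge.ProperTimeQuarantine

end
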